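import Summits.QuantumFields.YangMills.Theorems.BalabanLadderUVSeamRecClassicalResponseGlue
import Summits.QuantumFields.YangMills.Theorems.BalabanLadderUVSeamRecResponseMomentsTails
import HarnessLib

/-!
# Crux `UVSeamRec` (stmt-QuantumFields-20043), v6(β-cl) card: what «Gaussian domination» (GD) ∕ (EM_lin) says about ONE cube —
# a Gaussian TAIL for `√carrierCl`, an exponential-in-`√x` tail for the classical carrier (LEAD `ym-spine-20043-p1` g9)

Helper file (`--supports stmt-QuantumFields-20043`).  The would-be second stub of the by-name v6(β-cl) re-cut of
`stub_responseMomentsOdd6` (LEAD g8's line card, evidence #60; typed as `ClassicalResponse.GaussianDominationSU2 := ∃ m₁ v₁ β₁ ℓ₁,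
0 < ℓ₁ ∧ EMLin 1 β₁ ℓ₁ m₁ v₁`, p548409) is an extensive sub-Gaussian law in LINEAR sources for `√carrierCl` under Wilson's torus state.
This file records its singleton necessary condition in the form a Monte-Carlo desk tests on sampled exteriors — the analogue for (GD)
of `…ResponseMomentsTails` (p547810) for (RM):

* `measureReal_sqrt_carrierCl_ge_le_of_emLin` — (EM_lin) [`C`, `β₁`, `ℓ₁`, `m`, `v`] ⇒ for `β ≥ β₁`, `1 ≤ R`, `R·uRec β ≤ ℓ₁`, `4R+8 ≤ L`,
  `q.1 < q.2`, every site `x`, level `u` and Chernoff parameter `t > 0`: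
  `μ_{2L+1,β}{U : u ≤ √carrierCl_C(lift U)} ≤ exp(m t + v t²/2 − t u)`;
* `measureReal_sqrt_carrierCl_ge_le_gaussian` — optimised (`v > 0`, `m < u`): `≤ exp(−(u − m)²/(2v))`, a GAUSSIAN tail for `√carrierCl`;
* `measureReal_carrierCl_ge_le_of_emLin` — the same for the carrier: `μ{x ≤ carrierCl_C} ≤ exp(−(√x − m)²/(2v))` for `m < √x`
  (an `exp(−x/(2v) + O(√x))` tail of `X := carrierCl`; with `C = s = 1` and tree `β = β_std/2`, `X = β_std R⁴ (m₀ − m₁)` is exactly the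
  classical proxy `X_d` of LEAD g9's kit jobs j285653–j285658);
* `carrierTail_of_gaussianDominationSU2` — read off the NAMED (GD).

HONEST FRAMING: exponential Chebyshev on a CONDITIONAL chain's would-be stub; nothing of E0′, NT or the gap; not Clay.
-/

set_option autoImplicit false

noncomputable section

open MeasureTheory Filter Topology Finset
open Literature.MathematicalPhysics.QuantumFieldTheory (GaugeConfig LatticeRep wilsonMeasure isProbabilityMeasure_wilsonMeasure)
open Literature.MathematicalPhysics.QuantumLattice
open Literature.Probability.LatticeModels
open Summit.QuantumFields.YangMills.Cruxes.OSLegsFromFemtoAndGap.DlrCollarTransfer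
open Summit.QuantumFields.YangMills.Cruxes.UVSeamRec.ResponsePinning (measureReal_ge_le_of_torusE_exp_le)

namespace Summit.QuantumFields.YangMills.Cruxes.UVSeamRec.ClassicalResponse

section General

variable {G : Type} [Group G] [TopologicalSpace G] [IsTopologicalGroup G] [CompactSpace G]
  [MeasurableSpace G] [BorelSpace G] (r : LatticeRep G)

omit [BorelSpace G] in
/-- `η ↦ √carrierCl(η)` is continuous. [folklore] -/
theorem continuous_sqrt_carrierCl (C s β : ℝ) (R : ℕ) (q : Fin 4 × Fin 4) (x : Fin 4 → ℤ) :
    Continuous fun η => Real.sqrt (carrierCl r C s β R q x η) :=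
  Real.continuous_sqrt.comp (continuous_const.mul (continuous_classicalResponse (r := r) _ _ q x s))

end General

/-! ## The (EM_lin) singleton tail at `SU(2)`, fundamental representation, unit of record -/

section SU2

/-- **(EM_lin) forces a Chernoff tail for `√carrierCl`.**  Under `EMLin C β₁ ℓ₁ m v`: for `β ≥ β₁`, `1 ≤ R`, `R·uRec β ≤ ℓ₁`, `4R+8 ≤ L`,
`q.1 < q.2`, every site `x`, every level `u` and every `t > 0`,
`μ_{2L+1,β}{U : u ≤ √carrierCl_C(lift U)} ≤ exp(m|t| + (v/2)t² − t u)` (the singleton `n = 1`, `T = univ`, source `t` of (EM_lin),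
then exponential Chebyshev `measureReal_ge_le_of_torusE_exp_le`). [folklore] -/
theorem measureReal_sqrt_carrierCl_ge_le_of_emLin {C β₁ ℓ₁ m v : ℝ} (h : EMLin C β₁ ℓ₁ m v) {β : ℝ} (hβ : β₁ ≤ β)
    {L R : ℕ} (q : Fin 4 × Fin 4) (x : Fin 4 → ℤ) (hq : q.1 < q.2) (hR : 1 ≤ R)
    (hRu : (R : ℝ) * Transport.uRec β ≤ ℓ₁) (hRL : 4 * R + 8 ≤ L) (u : ℝ) {t : ℝ} (ht : 0 < t) :
    (wilsonMeasure (d := 4) (L := 2 * L + 1) (fundamentalLatticeRep 2).ρ β).real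
        {U : GaugeConfig 4 (2 * L + 1) (Matrix.specialUnitaryGroup (Fin 2) ℂ) |
          u ≤ Real.sqrt (carrierCl (fundamentalLatticeRep 2) C 1 β R q x (torusLift (2 * L + 1) U))} ≤
      Real.exp (m * |t| + v / 2 * t ^ 2 - t * u) := by
  have h1 := h β hβ L 1 (fun _ => q) (fun _ => x) R (fun _ => hq) hR hRu hRL
    (fun i j hij => absurd (Subsingleton.elim i j) hij) Finset.univ (fun _ => t)
  simp only [Finset.univ_unique, Finset.sum_singleton] at h1
  have hcheb := measureReal_ge_le_of_torusE_exp_le (fundamentalLatticeRep 2) β L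
    (f := fun η => t * Real.sqrt (carrierCl (fundamentalLatticeRep 2) C 1 β R q x η))
    (continuous_const.mul (continuous_sqrt_carrierCl (fundamentalLatticeRep 2) C 1 β R q x)) h1 (t * u)
  have hset : {U : GaugeConfig 4 (2 * L + 1) (Matrix.specialUnitaryGroup (Fin 2) ℂ) |
        u ≤ Real.sqrt (carrierCl (fundamentalLatticeRep 2) C 1 β R q x (torusLift (2 * L + 1) U))} =
      {U | t * u ≤ t * Real.sqrt (carrierCl (fundamentalLatticeRep 2) C 1 β R q x (torusLift (2 * L + 1) U))} := by
    ext U; simp only [Set.mem_setOf_eq]; exact (mul_le_mul_iff_of_pos_left ht).symm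
  rw [hset]
  exact hcheb

/-- **(EM_lin) forces a GAUSSIAN tail for `√carrierCl`** (optimised Chernoff parameter `t = (u − m)/v`): under `EMLin C β₁ ℓ₁ m v` with
`0 < v`, on the same guards, for every level `u > m`: `μ_{2L+1,β}{U : u ≤ √carrierCl_C(lift U)} ≤ exp(−(u − m)²/(2v))`. [folklore] -/
theorem measureReal_sqrt_carrierCl_ge_le_gaussian {C β₁ ℓ₁ m v : ℝ} (h : EMLin C β₁ ℓ₁ m v) (hv : 0 < v) {β : ℝ}
    (hβ : β₁ ≤ β) {L R : ℕ} (q : Fin 4 × Fin 4) (x : Fin 4 → ℤ) (hq : q.1 < q.2) (hR : 1 ≤ R)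
    (hRu : (R : ℝ) * Transport.uRec β ≤ ℓ₁) (hRL : 4 * R + 8 ≤ L) {u : ℝ} (hum : m < u) :
    (wilsonMeasure (d := 4) (L := 2 * L + 1) (fundamentalLatticeRep 2).ρ β).real
        {U : GaugeConfig 4 (2 * L + 1) (Matrix.specialUnitaryGroup (Fin 2) ℂ) |
          u ≤ Real.sqrt (carrierCl (fundamentalLatticeRep 2) C 1 β R q x (torusLift (2 * L + 1) U))} ≤
      Real.exp (-(u - m) ^ 2 / (2 * v)) := by
  have ht : 0 < (u - m) / v := div_pos (sub_pos.2 hum) hv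
  refine (measureReal_sqrt_carrierCl_ge_le_of_emLin h hβ q x hq hR hRu hRL u ht).trans_eq ?_
  congr 1
  rw [abs_of_pos ht]
  field_simp
  ring

/-- **(EM_lin) forces an exponential-in-`√x` tail for the classical carrier itself**: on the same guards, for every level `x` with
`m < √x`: `μ_{2L+1,β}{U : x ≤ carrierCl_C(lift U)} ≤ exp(−(√x − m)²/(2v))` (monotonicity of `√·`).  With `C = s = 1` this is the
law a disprover / Monte-Carlo desk reads against the sampled classical proxy `X_d = β_std R⁴(m₀ − m₁)`. [folklore] -/
theorem measureReal_carrierCl_ge_le_of_emLin {C β₁ ℓ₁ m v : ℝ} (h : EMLin C β₁ ℓ₁ m v) (hv : 0 < v) {β : ℝ}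
    (hβ : β₁ ≤ β) {L R : ℕ} (q : Fin 4 × Fin 4) (x : Fin 4 → ℤ) (hq : q.1 < q.2) (hR : 1 ≤ R)
    (hRu : (R : ℝ) * Transport.uRec β ≤ ℓ₁) (hRL : 4 * R + 8 ≤ L) {x' : ℝ} (hxm : m < Real.sqrt x') :
    (wilsonMeasure (d := 4) (L := 2 * L + 1) (fundamentalLatticeRep 2).ρ β).real
        {U : GaugeConfig 4 (2 * L + 1) (Matrix.specialUnitaryGroup (Fin 2) ℂ) |
          x' ≤ carrierCl (fundamentalLatticeRep 2) C 1 β R q x (torusLift (2 * L + 1) U)} ≤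
      Real.exp (-(Real.sqrt x' - m) ^ 2 / (2 * v)) := by
  haveI := (fundamentalLatticeRep 2).secondCountableTopology
  haveI := isProbabilityMeasure_wilsonMeasure (d := 4) (L := 2 * L + 1) (fundamentalLatticeRep 2).ρ
    (fundamentalLatticeRep 2).continuous β
  have hsub : {U : GaugeConfig 4 (2 * L + 1) (Matrix.specialUnitaryGroup (Fin 2) ℂ) |
        x' ≤ carrierCl (fundamentalLatticeRep 2) C 1 β R q x (torusLift (2 * L + 1) U)} ⊆
      {U | Real.sqrt x' ≤ Real.sqrt (carrierCl (fundamentalLatticeRep 2) C 1 β R q x (torusLift (2 * L + 1) U))} :=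
    fun U hU => Real.sqrt_le_sqrt hU
  exact (measureReal_mono hsub).trans (measureReal_sqrt_carrierCl_ge_le_gaussian h hv hβ q x hq hR hRu hRL hxm)

/-- **The named (GD) read as a tail law.**  `GaussianDominationSU2` ⇒ constants `(m, v, β₁, ℓ₁ > 0)` with the Chernoff tail
`μ_{2L+1,β}{U : u ≤ √carrierCl₁(lift U)} ≤ exp(m|t| + (v/2)t² − t u)` for all `t > 0`, `u`, on the guards of (EM_lin). [folklore] -/
theorem carrierTail_of_gaussianDominationSU2 (h : GaussianDominationSU2) :
    ∃ (m v β₁ ℓ₁ : ℝ), 0 < ℓ₁ ∧ ∀ β : ℝ, β₁ ≤ β → ∀ (L R : ℕ) (q : Fin 4 × Fin 4) (x : Fin 4 → ℤ), q.1 < q.2 → 1 ≤ R →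
      (R : ℝ) * Transport.uRec β ≤ ℓ₁ → 4 * R + 8 ≤ L → ∀ (u t : ℝ), 0 < t →
        (wilsonMeasure (d := 4) (L := 2 * L + 1) (fundamentalLatticeRep 2).ρ β).real
            {U : GaugeConfig 4 (2 * L + 1) (Matrix.specialUnitaryGroup (Fin 2) ℂ) |
              u ≤ Real.sqrt (carrierCl (fundamentalLatticeRep 2) 1 1 β R q x (torusLift (2 * L + 1) U))} ≤
          Real.exp (m * |t| + v / 2 * t ^ 2 - t * u) := by
  obtain ⟨m, v, β₁, ℓ₁, hℓ₁, hEM⟩ := h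
  exact ⟨m, v, β₁, ℓ₁, hℓ₁, fun β hβ L R q x hq hR hRu hRL u t ht =>
    measureReal_sqrt_carrierCl_ge_le_of_emLin hEM hβ q x hq hR hRu hRL u ht⟩

end SU2

end Summit.QuantumFields.YangMills.Cruxes.UVSeamRec.ClassicalResponse

end
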